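import Literature.NumberTheory.Transcendental.KZProductIdeal
import Literature.NumberTheory.Transcendental.KZFibredRelations
import Literature.NumberTheory.Transcendental.KZRulesAssociator
import Mathlib.Analysis.SpecialFunctions.Integrals.Basic

/-!
# `LogKernelConjecture` (stmt-KontsevichZagierPeriods-2837) — negative knowledge for the line
`spectator-localisation` (skeleton d39c9ad6): the engine's conclusion is SHARP

Drefute seat `refuter-drefute-stmt-KontsevichZagierPeriods-2837-g2-0` (gen 2), 2026-08-16. The line's
engine concludes `FibredSpectatorCancellation₁`:
`∀ (s : IntegralRep 1) c, s.value ≠ 0 → [s]·c ∈ KZ.fibredRelations → c ∈ KZ.relations` (a theorem: all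
four engine stubs are proved, candidate proofs attached to the item as `Engine.lean`). Its NATURAL
STRENGTHENING — conclude `c ∈ KZ.fibredRelations` — is FALSE
(`not_fibredSpectatorCancellation₁_fibred`): for the unit interval `u = [[0,1], 1]` and
`c = [u] − [pt, 1]` (one Newton–Leibniz move over the point, so `c ∈ relations`), the product
`[u]·c = [u × u] − [u × pt]` is a FIBRED Newton–Leibniz move (band of dimension `2` over a base of
dimension `1`), while `c ∉ fibredRelations`: fibred relations restrict to fibred relations on rational
slabs (`KZ.slabMap_mem_fibredRelations`) and evaluate to `0`, but `slabMap 0 1 c = [u|(0,1)]` has value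
`1`. So the detour of the engine through the NON-fibred unit move `[u]·c − c` is essential, and
`fibredRelations` does not contain the relations among constants and families that the kernel needs.

Second finding, CORRECTING the gen-1 mutation note ("`s.value ≠ 0` is not load-bearing for
`stub_spectatorFibration` in isolation", argued from the empty spectator only):
**`stub_spectatorFibration` with `s.value ≠ 0` deleted is FALSE** (`stubSpectatorFibration_false_without_value`).
Witness: the odd spectator `s = [[-1,1], t]` (value `0`, but non-zero slices) and `c = [pt, 1]`:
`[s] ∈ relations` (one Newton–Leibniz move, primitive `t²/2`), so `[s]·c ∈ relations`; but a `c' ≡ c`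
with `[s]·c' ∈ fibredRelations` cannot exist, because slab restriction commutes with left products by a
one-dimensional spectator (`slabMap_of_mul`: `slabMap a b ([s]·c') = [s|(a,b)]·c'`), fibred relations
restrict to fibred relations, and `eval ([s|(0,1)]·c') = ½ · eval c'` forces `eval c' = 0 ≠ 1 = eval c`.
So BOTH guards of the two conjunct stubs are exactly load-bearing. [folklore]
-/

noncomputable section

open MeasureTheory Set MvPolynomial
open Literature.NumberTheory.Transcendental

namespace Summit.KontsevichZagierPeriods.LiouvilleUnfolding.LogKernelConjectureNegative.SpectatorEngineSharp

/-! ## The unit interval `[[0,1], 1]` -/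

/-- `{0 ≤ t 0 ≤ 1} ⊆ ℝ¹` is `ℚ`-semialgebraic. [folklore] -/
theorem isSemialgebraic_unitIccSet :
    Literature.ModelTheory.ExponentialFields.IsSemialgebraic ℚ
      {t : Fin 1 → ℝ | (0 : ℝ) ≤ t 0 ∧ t 0 ≤ 1} := by
  have h1 := Literature.ModelTheory.ExponentialFields.isSemialgebraic_setOf_eval_le (k := ℚ) (R := ℝ)
    (C 0) (X (0 : Fin 1))
  have h2 := Literature.ModelTheory.ExponentialFields.isSemialgebraic_setOf_eval_le (k := ℚ) (R := ℝ)
    (X (0 : Fin 1)) (C 1)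
  simp only [aeval_X, map_zero, map_one] at h1 h2
  simpa [setOf_and] using h1.inter h2

/-- `{0 ≤ t 0 ≤ 1} ⊆ ℝ¹` is the box `∏ [0, 1]`. [folklore] -/
theorem unitIccSet_eq_pi :
    {t : Fin 1 → ℝ | (0 : ℝ) ≤ t 0 ∧ t 0 ≤ 1} = Set.pi univ (fun _ => Icc (0 : ℝ) 1) := by
  ext t
  simp [Pi.le_def, Fin.forall_fin_one]

/-- **The unit interval representation exists**: domain `{0 ≤ t 0 ≤ 1}`, integrand `1`, value `1`
(an existence statement, so that this file declares no objects). [folklore] -/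
theorem exists_unitIntervalRep :
    ∃ u : KZ.IntegralRep 1, u.domain = {t : Fin 1 → ℝ | (0 : ℝ) ≤ t 0 ∧ t 0 ≤ 1} ∧
      (u.integrand = fun _ => 1) ∧ u.value = 1 := by
  refine ⟨{ domain := {t : Fin 1 → ℝ | (0 : ℝ) ≤ t 0 ∧ t 0 ≤ 1}
            integrand := fun _ => 1
            isSemialgebraic_domain := isSemialgebraic_unitIccSet
            isSemialgebraicFunOn_integrand := by
              simpa using isSemialgebraicFunOn_aeval isSemialgebraic_unitIccSet 1
            integrableOn := by
              refine integrableOn_const ?_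
              rw [unitIccSet_eq_pi, volume_pi_pi]
              simp [Real.volume_Icc] }, rfl, rfl, ?_⟩
  rw [KZ.IntegralRep.value]
  simp only [setIntegral_const, smul_eq_mul, mul_one, Measure.real, unitIccSet_eq_pi, volume_pi_pi,
    Real.volume_Icc, sub_zero, ENNReal.ofReal_one, Finset.prod_const_one, ENNReal.toReal_one]

/-! ## `[u]·([u] − [pt,1])` is a fibred Newton–Leibniz move -/

/-- For the unit interval `u`, `[u × u] − [u × pt]` is a Newton–Leibniz move along the last coordinate
over the base `u × pt` of dimension `1` (primitive `F(z) = z₁`, bounds `0 ≤ 1`). [folklore] -/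
theorem of_prod_sub_of_prod_unit_mem_newtonLeibnizRel (u : KZ.IntegralRep 1)
    (hdom : u.domain = {t : Fin 1 → ℝ | (0 : ℝ) ≤ t 0 ∧ t 0 ≤ 1}) (hint : u.integrand = fun _ => 1) :
    KZ.of (u.prod u) - KZ.of (u.prod KZ.IntegralRep.unit) ∈ KZ.newtonLeibnizRel := by
  have e1 : (Fin.castAdd 1 (0 : Fin 1) : Fin (1 + 1)) = 0 := rfl
  have e2 : (Fin.natAdd 1 (0 : Fin 1) : Fin (1 + 1)) = Fin.last 1 := rfl
  have e3 : ∀ z : Fin (1 + 1) → ℝ, (Fin.init z : Fin 1 → ℝ) (Fin.castAdd 0 (0 : Fin 1)) = z 0 :=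
    fun z => rfl
  have e4 : ∀ (x : Fin 1 → ℝ) (t : ℝ), (Fin.snoc x t : Fin (1 + 1) → ℝ) 0 = x 0 := fun x t => by
    have : (0 : Fin (1 + 1)) = Fin.castSucc (0 : Fin 1) := rfl
    rw [this, Fin.snoc_castSucc]
  refine ⟨1, u.prod u, u.prod KZ.IntegralRep.unit, fun _ => 0, fun _ => 1, fun z => z (Fin.last 1),
    ?_, ?_, ?_, fun _ _ => zero_le_one, ?_, fun x _ => ?_, fun x _ t _ => ?_, fun x _ => ?_, rfl⟩
  · simpa using isSemialgebraicFunOn_aeval (u.prod u).isSemialgebraic_domain (X (Fin.last 1))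
  · simpa using isSemialgebraicFunOn_aeval (u.prod KZ.IntegralRep.unit).isSemialgebraic_domain 0
  · simpa using isSemialgebraicFunOn_aeval (u.prod KZ.IntegralRep.unit).isSemialgebraic_domain 1
  · ext z
    simp only [KZ.IntegralRep.prod_domain, KZ.IntegralRep.prodDomain, hdom, mem_setOf_eq, e1, e2, e3,
      KZ.IntegralRep.unit_domain, mem_univ, and_true]
  · simp only [Fin.snoc_last]
    exact continuousOn_id
  · simp only [Fin.snoc_last, KZ.IntegralRep.prod_integrand_eq, KZ.IntegralRep.prodFun_apply, hint,
      mul_one]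
    exact hasDerivAt_id t
  · simp only [KZ.IntegralRep.prod_integrand_eq, KZ.IntegralRep.prodFun_apply, hint,
      KZ.IntegralRep.unit_integrand, Fin.snoc_last, mul_one]
    norm_num

/-- Hence `[u]·([u] − [pt,1]) ∈ KZ.fibredRelations` (the move is fibred: base dimension `1 ≥ 1`).
[folklore] -/
theorem of_mul_sub_mem_fibredRelations (u : KZ.IntegralRep 1)
    (hdom : u.domain = {t : Fin 1 → ℝ | (0 : ℝ) ≤ t 0 ∧ t 0 ≤ 1}) (hint : u.integrand = fun _ => 1) :
    KZ.of u * (KZ.of u - KZ.of KZ.IntegralRep.unit) ∈ KZ.fibredRelations := by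
  rw [mul_sub, KZ.of_mul_of, KZ.of_mul_of]
  exact KZ.mem_fibredRelations_of_mem_fibredNewtonLeibnizRel
    (KZ.of_sub_of_mem_fibredNewtonLeibnizRel (n := 0)
      (of_prod_sub_of_prod_unit_mem_newtonLeibnizRel u hdom hint))

/-! ## `[u] − [pt,1]` is not a fibred relation -/

/-- The value of the unit interval restricted to the open slab `(0,1)` is `1`. [folklore] -/
theorem value_slabRestrict_unitInterval (u : KZ.IntegralRep 1)
    (hdom : u.domain = {t : Fin 1 → ℝ | (0 : ℝ) ≤ t 0 ∧ t 0 ≤ 1}) (hint : u.integrand = fun _ => 1) :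
    (u.slabRestrict 0 1).value = 1 := by
  have hset : (u.slabRestrict 0 1).domain = Set.pi univ (fun _ => Ioo (0 : ℝ) 1) := by
    ext t
    simp only [KZ.IntegralRep.domain_slabRestrict, hdom, mem_inter_iff, mem_setOf_eq, KZ.mem_paramSlab,
      Rat.cast_zero, Rat.cast_one, mem_pi, mem_univ, true_implies, mem_Ioo]
    constructor
    · rintro ⟨-, h1, h2⟩ i
      rw [Fin.eq_zero i]
      exact ⟨h1, h2⟩
    · intro h
      exact ⟨⟨(h 0).1.le, (h 0).2.le⟩, (h 0).1, (h 0).2⟩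
  rw [KZ.IntegralRep.value, hset, KZ.IntegralRep.integrand_slabRestrict, hint]
  simp only [setIntegral_const, smul_eq_mul, mul_one, Measure.real, volume_pi_pi, Real.volume_Ioo,
    sub_zero, ENNReal.ofReal_one, Finset.prod_const_one, ENNReal.toReal_one]

/-- **`[u] − [pt,1] ∉ KZ.fibredRelations`** although it is a relation: its slab restriction
`slabMap 0 1 ([u] − [pt,1]) = [u|(0,1)]` would be a fibred relation of value `1`. [folklore] -/
theorem of_sub_of_unit_not_mem_fibredRelations (u : KZ.IntegralRep 1)
    (hdom : u.domain = {t : Fin 1 → ℝ | (0 : ℝ) ≤ t 0 ∧ t 0 ≤ 1}) (hint : u.integrand = fun _ => 1) :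
    KZ.of u - KZ.of KZ.IntegralRep.unit ∉ KZ.fibredRelations := by
  intro h
  have h1 := KZ.slabMap_mem_fibredRelations h 0 1
  rw [map_sub, KZ.slabMap_of, KZ.slabMap_of_zero, sub_zero] at h1
  have h2 := KZ.fibredRelations_le_ker_eval h1
  rw [AddMonoidHom.mem_ker, KZ.eval_of, value_slabRestrict_unitInterval u hdom hint] at h2
  exact one_ne_zero h2

/-- `[u] − [pt,1] ∈ KZ.relations` (one Newton–Leibniz move over the point, primitive `t`). [folklore] -/
theorem of_sub_of_unit_mem_relations (u : KZ.IntegralRep 1)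
    (hdom : u.domain = {t : Fin 1 → ℝ | (0 : ℝ) ≤ t 0 ∧ t 0 ≤ 1}) (hint : u.integrand = fun _ => 1) :
    KZ.of u - KZ.of KZ.IntegralRep.unit ∈ KZ.relations := by
  apply KZ.newtonLeibnizRel_subset_relations
  refine ⟨0, u, KZ.IntegralRep.unit, fun _ => 0, fun _ => 1, fun z => z (Fin.last 0), ?_, ?_, ?_,
    fun _ _ => zero_le_one, ?_, fun x _ => ?_, fun x _ t _ => ?_, fun x _ => ?_, rfl⟩
  · simpa using isSemialgebraicFunOn_aeval u.isSemialgebraic_domain (X (Fin.last 0))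
  · simpa using isSemialgebraicFunOn_aeval KZ.IntegralRep.unit.isSemialgebraic_domain 0
  · simpa using isSemialgebraicFunOn_aeval KZ.IntegralRep.unit.isSemialgebraic_domain 1
  · ext z
    simp only [hdom, mem_setOf_eq, KZ.IntegralRep.unit_domain, mem_univ, true_and]
    rfl
  · simp only [Fin.snoc_last]
    exact continuousOn_id
  · simp only [Fin.snoc_last, hint]
    exact hasDerivAt_id t
  · simp only [KZ.IntegralRep.unit_integrand, Fin.snoc_last]
    norm_num

/-! ## The strengthened engine conclusion is false -/

/-- **`FibredSpectatorCancellation₁` cannot conclude `c ∈ fibredRelations`**: the unit-interval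
spectator `u` (value `1`) and `c = [u] − [pt,1]` have `[u]·c ∈ fibredRelations` but
`c ∉ fibredRelations`. [folklore] -/
theorem not_fibredSpectatorCancellation₁_fibred :
    ¬ ∀ (s : KZ.IntegralRep 1) (c : KZ.FormalRep), s.value ≠ 0 →
        KZ.of s * c ∈ KZ.fibredRelations → c ∈ KZ.fibredRelations := by
  intro h
  obtain ⟨u, hdom, hint, hval⟩ := exists_unitIntervalRep
  exact of_sub_of_unit_not_mem_fibredRelations u hdom hint
    (h u _ (by rw [hval]; exact one_ne_zero) (of_mul_sub_mem_fibredRelations u hdom hint))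

/-- The same witness shows `KZ.fibredRelations < KZ.relations` strictly, even on elements of value `0`
built from families and constants. [folklore] -/
theorem fibredRelations_lt_relations : KZ.fibredRelations < KZ.relations := by
  refine lt_of_le_of_ne KZ.fibredRelations_le_relations fun h => ?_
  obtain ⟨u, hdom, hint, -⟩ := exists_unitIntervalRep
  exact of_sub_of_unit_not_mem_fibredRelations u hdom hint
    (h ▸ of_sub_of_unit_mem_relations u hdom hint)

/-! ## `s.value ≠ 0` IS load-bearing for `stub_spectatorFibration` -/

/-- `{-1 ≤ t 0 ≤ 1} ⊆ ℝ¹` is `ℚ`-semialgebraic. [folklore] -/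
theorem isSemialgebraic_symIccSet :
    Literature.ModelTheory.ExponentialFields.IsSemialgebraic ℚ
      {t : Fin 1 → ℝ | (-1 : ℝ) ≤ t 0 ∧ t 0 ≤ 1} := by
  have h1 := Literature.ModelTheory.ExponentialFields.isSemialgebraic_setOf_eval_le (k := ℚ) (R := ℝ)
    (C (-1)) (X (0 : Fin 1))
  have h2 := Literature.ModelTheory.ExponentialFields.isSemialgebraic_setOf_eval_le (k := ℚ) (R := ℝ)
    (X (0 : Fin 1)) (C 1)
  simp only [aeval_X, map_neg, map_one] at h1 h2
  simpa [setOf_and] using h1.inter h2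

/-- `{-1 ≤ t 0 ≤ 1}` is the box `∏ [-1, 1]`. [folklore] -/
theorem symIccSet_eq_pi :
    {t : Fin 1 → ℝ | (-1 : ℝ) ≤ t 0 ∧ t 0 ≤ 1} = Set.pi univ (fun _ => Icc (-1 : ℝ) 1) := by
  ext t
  simp [Pi.le_def, Fin.forall_fin_one]

/-- **The odd spectator exists**: `[[-1,1], t]` (domain `{-1 ≤ t 0 ≤ 1}`, integrand `t ↦ t 0`).
[folklore] -/
theorem exists_oddRep :
    ∃ s : KZ.IntegralRep 1, s.domain = {t : Fin 1 → ℝ | (-1 : ℝ) ≤ t 0 ∧ t 0 ≤ 1} ∧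
      s.integrand = fun t => t 0 :=
  ⟨{ domain := {t : Fin 1 → ℝ | (-1 : ℝ) ≤ t 0 ∧ t 0 ≤ 1}
     integrand := fun t => t 0
     isSemialgebraic_domain := isSemialgebraic_symIccSet
     isSemialgebraicFunOn_integrand := by
       simpa using isSemialgebraicFunOn_aeval isSemialgebraic_symIccSet (X (0 : Fin 1))
     integrableOn := by
       refine (ContinuousOn.integrableOn_compact ?_ (continuous_apply 0).continuousOn)
       rw [symIccSet_eq_pi]
       exact isCompact_univ_pi fun _ => isCompact_Icc }, rfl, rfl⟩

/-- **`[[-1,1], t] ∈ KZ.relations`**: one Newton–Leibniz move over the point with primitive `t²/2`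
gives `[s] − [pt, 0]`, and `[pt, 0]` is a relation (zero integrand). [folklore] -/
theorem of_oddRep_mem_relations (s : KZ.IntegralRep 1)
    (hdom : s.domain = {t : Fin 1 → ℝ | (-1 : ℝ) ≤ t 0 ∧ t 0 ≤ 1}) (hint : s.integrand = fun t => t 0) :
    KZ.of s ∈ KZ.relations := by
  -- the constant `[pt, 0]`
  let z : KZ.IntegralRep 0 :=
    { domain := univ
      integrand := fun _ => 0
      isSemialgebraic_domain := Literature.ModelTheory.ExponentialFields.isSemialgebraic_univ
      isSemialgebraicFunOn_integrand := by
        simpa using isSemialgebraicFunOn_aeval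
          (Literature.ModelTheory.ExponentialFields.isSemialgebraic_univ (k := ℚ)
            (ι := Fin 0) (R := ℝ)) 0
      integrableOn := integrableOn_zero }
  have hz : KZ.of z ∈ KZ.relations := by
    have h1 : KZ.of z - KZ.of z - KZ.of z ∈ KZ.relations :=
      KZ.integrandAddRel_subset_relations ⟨0, z, z, z, rfl, rfl, fun x _ => by simp [z], rfl⟩
    have h2 := KZ.relations.neg_mem h1
    have h3 : -(KZ.of z - KZ.of z - KZ.of z) = KZ.of z := by abel
    rwa [h3] at h2
  have hzd : z.domain = univ := rfl
  have hzi : z.integrand = fun _ => 0 := rfl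
  have e0 : ∀ (x : Fin 0 → ℝ) (t : ℝ), (Fin.snoc x t : Fin 1 → ℝ) 0 = t := fun x t => rfl
  have hNL : KZ.of s - KZ.of z ∈ KZ.relations := by
    apply KZ.newtonLeibnizRel_subset_relations
    refine ⟨0, s, z, fun _ => -1, fun _ => 1, fun w => w (Fin.last 0) * w (Fin.last 0) * 2⁻¹,
      ?_, ?_, ?_, fun _ _ => by norm_num, ?_, fun x _ => ?_, fun x _ t _ => ?_, fun x _ => ?_, rfl⟩
    · refine (isSemialgebraicFunOn_aeval s.isSemialgebraic_domain
        (X (Fin.last 0) * X (Fin.last 0) * C (2⁻¹ : ℚ))).congr fun w _ => ?_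
      simp only [map_mul, aeval_X, aeval_C, eq_ratCast, Rat.cast_inv, Rat.cast_ofNat]
    · simpa using isSemialgebraicFunOn_aeval
        (Literature.ModelTheory.ExponentialFields.isSemialgebraic_univ (k := ℚ) (ι := Fin 0) (R := ℝ))
        (C (-1))
    · simpa using isSemialgebraicFunOn_aeval
        (Literature.ModelTheory.ExponentialFields.isSemialgebraic_univ (k := ℚ) (ι := Fin 0) (R := ℝ)) 1
    · ext w
      simp only [hdom, mem_setOf_eq, hzd, mem_univ, true_and]
      rfl
    · simp only [Fin.snoc_last]
      fun_prop
    · have hi : s.integrand (Fin.snoc x t) = t := by rw [hint]; exact e0 x t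
      rw [hi]
      simp only [Fin.snoc_last]
      have hd : HasDerivAt (fun r : ℝ => r * r * 2⁻¹) ((1 * t + t * 1) * 2⁻¹) t :=
        ((hasDerivAt_id' t).mul (hasDerivAt_id' t)).mul_const _
      convert hd using 1
      ring
    · simp only [Fin.snoc_last, hzi]
      norm_num
  have := KZ.relations.add_mem hNL hz
  rwa [sub_add_cancel] at this

/-- The slab `{a < z₀ < b}` in dimension `m ≥ 1` is `ℚ`-semialgebraic. [folklore] -/
theorem isSemialgebraic_slab {m : ℕ} (hm : 0 < m) (a b : ℚ) :
    Literature.ModelTheory.ExponentialFields.IsSemialgebraic ℚ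
      {z : Fin m → ℝ | (a : ℝ) < z ⟨0, hm⟩ ∧ z ⟨0, hm⟩ < (b : ℝ)} := by
  have h1 := Literature.ModelTheory.ExponentialFields.isSemialgebraic_setOf_eval_lt (k := ℚ) (R := ℝ)
    (C a) (X (⟨0, hm⟩ : Fin m))
  have h2 := Literature.ModelTheory.ExponentialFields.isSemialgebraic_setOf_eval_lt (k := ℚ) (R := ℝ)
    (X (⟨0, hm⟩ : Fin m)) (C b)
  simp only [aeval_X, aeval_C, eq_ratCast] at h1 h2
  simpa [setOf_and] using h1.inter h2

/-- `slabMap` on a generator of any positive dimension (the pattern match of `KZ.slabGen` made usable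
for dimensions such as `1 + k`). [folklore] -/
theorem slabMap_of_pos {m : ℕ} (hm : 0 < m) (R : KZ.IntegralRep m) (a b : ℚ) :
    KZ.slabMap a b (KZ.of R) =
      KZ.of (R.restrict (R.domain ∩ {z | (a : ℝ) < z ⟨0, hm⟩ ∧ z ⟨0, hm⟩ < (b : ℝ)})
        (R.isSemialgebraic_domain.inter (isSemialgebraic_slab hm a b)) inter_subset_left) := by
  obtain ⟨n, rfl⟩ : ∃ n, m = n + 1 := ⟨m - 1, by omega⟩
  rw [KZ.slabMap_of]
  rfl

/-- **Slab restriction commutes with left products by a one-dimensional spectator**: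
`slabMap a b ([s]·c) = [s|(a,b)]·c`. [folklore] -/
theorem slabMap_of_mul (s : KZ.IntegralRep 1) (a b : ℚ) (c : KZ.FormalRep) :
    KZ.slabMap a b (KZ.of s * c) = KZ.of (s.slabRestrict a b) * c := by
  induction c using FreeAbelianGroup.induction_on with
  | zero => simp
  | of x =>
    obtain ⟨k, r⟩ := x
    change KZ.slabMap a b (KZ.of s * KZ.of r) = KZ.of (s.slabRestrict a b) * KZ.of r
    have hk : 0 < 1 + k := by omega
    have i0 : Fin.castAdd k (0 : Fin 1) = (⟨0, hk⟩ : Fin (1 + k)) := Fin.ext (by simp)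
    rw [KZ.of_mul_of, KZ.of_mul_of, slabMap_of_pos hk]
    congr 1
    refine KZ.IntegralRep.ext' ?_ ?_
    · ext w
      simp only [KZ.IntegralRep.domain_restrict, KZ.IntegralRep.prod_domain, KZ.IntegralRep.prodDomain,
        KZ.IntegralRep.domain_slabRestrict, mem_inter_iff, mem_setOf_eq, KZ.mem_paramSlab, i0]
      tauto
    · rw [KZ.IntegralRep.integrand_restrict, KZ.IntegralRep.prod_integrand_eq,
        KZ.IntegralRep.prod_integrand_eq]
      rfl
  | neg x ih => rw [mul_neg, map_neg, ih, mul_neg]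
  | add x y hx hy => rw [mul_add, map_add, hx, hy, mul_add]

/-- The odd spectator restricted to the slab `(0,1)` has value `1/2`. [folklore] -/
theorem value_slabRestrict_oddRep (s : KZ.IntegralRep 1)
    (hdom : s.domain = {t : Fin 1 → ℝ | (-1 : ℝ) ≤ t 0 ∧ t 0 ≤ 1}) (hint : s.integrand = fun t => t 0) :
    (s.slabRestrict 0 1).value = 1 / 2 := by
  have hpre : (s.slabRestrict 0 1).domain = MeasurableEquiv.funUnique (Fin 1) ℝ ⁻¹' Ioo 0 1 := by
    ext x
    simp only [KZ.IntegralRep.domain_slabRestrict, hdom, mem_inter_iff, mem_setOf_eq, KZ.mem_paramSlab,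
      Rat.cast_zero, Rat.cast_one, mem_preimage, mem_Ioo, MeasurableEquiv.funUnique_apply,
      Fin.default_eq_zero]
    constructor
    · rintro ⟨-, h1, h2⟩
      exact ⟨h1, h2⟩
    · rintro ⟨h1, h2⟩
      exact ⟨⟨by linarith, h2.le⟩, h1, h2⟩
  have key := (MeasureTheory.volume_preserving_funUnique (Fin 1) ℝ).setIntegral_preimage_emb
    (MeasurableEquiv.measurableEmbedding _) (fun t : ℝ => t) (Ioo 0 1)
  have hval : ∫ y in Ioo (0 : ℝ) 1, (fun t : ℝ => t) y = 1 / 2 := by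
    rw [← integral_Ioc_eq_integral_Ioo, ← intervalIntegral.integral_of_le zero_le_one, integral_id]
    norm_num
  rw [hval] at key
  rw [KZ.IntegralRep.value, KZ.IntegralRep.integrand_slabRestrict, hint, hpre, ← key]
  rfl

/-- **A fibred certificate for `[s]·c'` with the odd spectator forces `eval c' = 0`**: restrict to the
slab `(0,1)` (`slabMap_of_mul`, `KZ.slabMap_mem_fibredRelations`), where the spectator has value `1/2`,
and use soundness and multiplicativity of `eval`. [folklore] -/
theorem eval_eq_zero_of_oddRep_mul_mem_fibredRelations (s : KZ.IntegralRep 1)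
    (hdom : s.domain = {t : Fin 1 → ℝ | (-1 : ℝ) ≤ t 0 ∧ t 0 ≤ 1}) (hint : s.integrand = fun t => t 0)
    {c' : KZ.FormalRep} (h : KZ.of s * c' ∈ KZ.fibredRelations) : KZ.eval c' = 0 := by
  have h1 := KZ.slabMap_mem_fibredRelations h 0 1
  rw [slabMap_of_mul] at h1
  have h2 := KZ.fibredRelations_le_ker_eval h1
  rw [AddMonoidHom.mem_ker, KZ.eval_mul', KZ.eval_of, value_slabRestrict_oddRep s hdom hint] at h2
  have : (1 / 2 : ℝ) ≠ 0 := by norm_num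
  exact (mul_eq_zero.mp h2).resolve_left this

/-- **`stub_spectatorFibration` is FALSE without `s.value ≠ 0`** (the stub verbatim, that hypothesis
deleted): the odd spectator `s = [[-1,1], t]` has `[s]·[pt,1] ∈ relations` (`[s]` itself is a
relation), but every `c' ≡ [pt,1]` has `eval c' = 1`, whereas a fibred certificate for `[s]·c'` forces
`eval c' = 0`. Corrects the gen-1 note: the guard is load-bearing (the empty spectator merely fails
to witness it). [folklore] -/
theorem stubSpectatorFibration_false_without_value :
    ¬ ∀ (s : KZ.IntegralRep 1) (c : KZ.FormalRep), KZ.of s * c ∈ KZ.relations →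
        ∃ c' : KZ.FormalRep, c - c' ∈ KZ.relations ∧ KZ.of s * c' ∈ KZ.fibredRelations := by
  intro h
  obtain ⟨s, hdom, hint⟩ := exists_oddRep
  have hs : KZ.of s ∈ KZ.relations := of_oddRep_mem_relations s hdom hint
  obtain ⟨c', hcc', hc'⟩ := h s (KZ.of KZ.IntegralRep.unit) (KZ.mul_mem_relations_right_holds _ _ hs)
  have h0 := eval_eq_zero_of_oddRep_mul_mem_fibredRelations s hdom hint hc'
  have h1 := KZ.relations_le_ker_eval_holds hcc'
  rw [AddMonoidHom.mem_ker, map_sub, KZ.eval_of, KZ.IntegralRep.value_unit, h0, sub_zero] at h1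
  exact one_ne_zero h1

/-- The same witness for plain cancellation: **`SC₁` without `s.value ≠ 0` is FALSE** even at a
NON-EMPTY spectator (`[[-1,1], t]·[pt,1] ∈ relations`, `[pt,1] ∉ relations`). [folklore] -/
theorem spectatorCancellation₁_false_without_value :
    ¬ ∀ (s : KZ.IntegralRep 1) (c : KZ.FormalRep), s.domain.Nonempty →
        KZ.of s * c ∈ KZ.relations → c ∈ KZ.relations := by
  intro h
  obtain ⟨s, hdom, hint⟩ := exists_oddRep
  have hne : s.domain.Nonempty := ⟨fun _ => 0, by rw [hdom]; norm_num⟩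
  have h1 := h s (KZ.of KZ.IntegralRep.unit) hne
    (KZ.mul_mem_relations_right_holds _ _ (of_oddRep_mem_relations s hdom hint))
  have h2 := KZ.relations_le_ker_eval_holds h1
  rw [AddMonoidHom.mem_ker, KZ.eval_of, KZ.IntegralRep.value_unit] at h2
  exact one_ne_zero h2

end Summit.KontsevichZagierPeriods.LiouvilleUnfolding.LogKernelConjectureNegative.SpectatorEngineSharp
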